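import Literature.Algebra.EuclideanLattices.DiscreteGaussianInt
import Literature.Algebra.EuclideanLattices.ScaledIntLattice
import Literature.Probability.Distributions.IndepProductLaw
import HarnessLib

/-!
# The fine grid `(1/N)ℤⁿ` (`fineGrid`) and its discrete Gaussian as a product of one-dimensional discrete Gaussians

Topic `Algebra/EuclideanLattices` (family `pqc`). The bit-level renderings of the lattice reductions of
the tree (Micciancio–Regev 2007, Thm. 5.9 / Cor. 5.13 / Thm. 5.23 behind
`Literature.Computability.Cryptography.owfExist_of_gapSVP_worstCaseHard`) run the sampling procedure of
MR07 Lemma 5.7 in its fine-grid form (`GaussianSublatticeUniformity.lean`: for ANY superlattice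
`L' ⊇ L`, `r ∼ D_{L',s,t}`, `c = -r mod L`, `y = r + rep c`). A machine that samples with independent
coins coordinate by coordinate must take for `L'` the INTEGER fine grid `(1/N)ℤⁿ ⊇ ℤⁿ ⊇ L` (`L`
integral), on which the spherical discrete Gaussian FACTORISES: `ρ_s(k/N - t) = ∏ᵢ ρ_{Ns}(kᵢ - Ntᵢ)`.
This file sets up that grid and proves the factorisation at the level of the tree's `PMF`s:

* `fineGrid n N` — an abbreviation for the tree's `invScaledIntLattice n N = (1/N)ℤⁿ`
  (`ScaledIntLattice.lean`: a `ZSpan`, `mem_invScaledIntLattice_iff`, `stdIntLattice_le_invScaledIntLattice`);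
* `fineGridVec n N k = k/N` and the additive equivalence `fineGridEquiv n N : ℤⁿ ≃+ (1/N)ℤⁿ`;
* `gaussianFunction_fineGridVec_sub` — `ρ_s(k/N - t) = ∏ᵢ ρ_{Ns}(kᵢ - N tᵢ)`;
* **`discreteGaussian_fineGrid_eq_map`** — for `0 < s`:
  `D_{(1/N)ℤⁿ, s, t} = (⨂ᵢ D_{ℤ, Ns, Ntᵢ}) ∘ fineGridEquiv⁻¹`, i.e. sampling `kᵢ ∼ D_{ℤ,Ns,Ntᵢ}`
  independently and returning `k/N` samples the grid Gaussian EXACTLY (`indepLaw`,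
  `discreteGaussianInt`);
* `discreteGaussianInt_map_add_int` / `indepLaw_discreteGaussianInt_map_add` — integer shifts of the
  centre: `D_{ℤ,σ,0} + c = D_{ℤ,σ,c}` for `c ∈ ℤ` (coordinatewise for vectors), so that a sampler for the
  CENTRED one-dimensional law suffices whenever the centre `t` is itself a grid vector;
* the tool `PMF.eq_of_apply_eq_const_mul` (two laws proportional to the same weight are equal).

Everything is proved; the definitions have bodies; no named fact.

## References

* D. Micciancio, O. Regev, *Worst-case to average-case reductions based on Gaussian measures*,
  SIAM J. Comput. 37 (2007) 267–302, §2 (`ρ_s`, `D_{L,s,c}`), Lemma 5.7 and the grid convention p. 8.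
* C. Gentry, C. Peikert, V. Vaikuntanathan, *Trapdoors for hard lattices and new cryptographic
  constructions*, STOC 2008, §4.1 (`D_{ℤⁿ,s,c}` is sampled coordinatewise from `D_{ℤ,s,cᵢ}`)
  [GentryPeikertVaikuntanathan2008].
-/

noncomputable section

namespace Literature.Algebra.EuclideanLattices

open Module Submodule Literature.Probability.Distributions
open scoped ENNReal

/-! ### A tool: proportional laws are equal -/

/-- **Two probability mass functions proportional to the same weight are equal**: if `p = u·F` and
`q = v·F` pointwise then `p = q` (both constants are `(∑ F)⁻¹`). [folklore] -/
theorem _root_.PMF.eq_of_apply_eq_const_mul {α : Type*} (p q : PMF α) (F : α → ℝ≥0∞) (u v : ℝ≥0∞)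
    (hp : ∀ a, p a = u * F a) (hq : ∀ a, q a = v * F a) : p = q := by
  have hS_p : u * ∑' a, F a = 1 := by rw [← ENNReal.tsum_mul_left, ← tsum_congr hp]; exact p.tsum_coe
  have hS_q : v * ∑' a, F a = 1 := by rw [← ENNReal.tsum_mul_left, ← tsum_congr hq]; exact q.tsum_coe
  set S := ∑' a, F a with hS
  have hS0 : S ≠ 0 := by intro h; rw [h, mul_zero] at hS_p; exact zero_ne_one hS_p
  have hStop : S ≠ ∞ := by
    intro h
    rw [h] at hS_p
    rcases eq_or_ne u 0 with hu | hu
    · rw [hu, zero_mul] at hS_p; exact zero_ne_one hS_p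
    · rw [ENNReal.mul_top hu] at hS_p; exact ENNReal.top_ne_one hS_p
  have hu : u = S⁻¹ := ENNReal.eq_inv_of_mul_eq_one_left hS_p
  have hv : v = S⁻¹ := ENNReal.eq_inv_of_mul_eq_one_left hS_q
  ext a
  rw [hp, hq, hu, hv]

/-- The push-forward along an injection, evaluated at an image point (a private copy of the helper
`Literature.Computability.Cryptography.pmf_map_apply_of_injective` of `LWERegevTransforms.lean`, kept
local to avoid an upward import into the LWE files). [folklore] -/
private theorem pmf_map_apply_of_injective {α β : Type*} (p : PMF α) {f : α → β} (hf : Function.Injective f)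
    (a : α) : (p.map f) (f a) = p a := by
  rw [PMF.map_apply, tsum_eq_single a]
  · rw [if_pos rfl]
  · intro a' ha'
    rw [if_neg]
    exact fun h => ha' (hf h.symm)

/-! ### The grid `(1/N)ℤⁿ` -/

variable (n N : ℕ) [NeZero N]

/-- **The fine grid `(1/N)ℤⁿ`**: the tree's `invScaledIntLattice n N` (`ScaledIntLattice.lean`), under
the name the fine-grid sampling files use. [cite: MicciancioRegev2007, §5 (p. 8, "a sufficiently fine grid")] -/
abbrev fineGrid : Submodule ℤ (EuclideanSpace ℝ (Fin n)) := invScaledIntLattice n N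

/-! ### Grid vectors from integer vectors -/

/-- The grid vector `k/N` of an integer vector `k`. [folklore] -/
def fineGridVec (k : Fin n → ℤ) : EuclideanSpace ℝ (Fin n) := (N : ℝ)⁻¹ • intVecToEuclidean n k

omit [NeZero N] in
/-- Coordinates of `fineGridVec`: `(k/N)ᵢ = kᵢ/N`. [folklore] -/
@[simp] theorem fineGridVec_apply (k : Fin n → ℤ) (i : Fin n) : fineGridVec n N k i = (k i : ℝ) / N := by
  simp [fineGridVec, div_eq_inv_mul]

omit [NeZero N] in
/-- `fineGridVec` is additive. [folklore] -/
theorem fineGridVec_add (k l : Fin n → ℤ) : fineGridVec n N (k + l) = fineGridVec n N k + fineGridVec n N l := by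
  simp [fineGridVec, smul_add]

/-- Grid vectors of integer vectors lie in the grid. [folklore] -/
theorem fineGridVec_mem (k : Fin n → ℤ) : fineGridVec n N k ∈ fineGrid n N := by
  rw [mem_invScaledIntLattice_iff]
  intro i
  refine ⟨k i, ?_⟩
  rw [fineGridVec_apply, mul_div_cancel₀ _ (NeZero.ne (N : ℝ))]

/-- A grid vector is `k/N` for the integer vector `kᵢ = N xᵢ`. [folklore] -/
theorem fineGridVec_floor_eq {x : EuclideanSpace ℝ (Fin n)} (hx : x ∈ fineGrid n N) :
    fineGridVec n N (fun i => ⌊(N : ℝ) * x i⌋) = x := by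
  rw [mem_invScaledIntLattice_iff] at hx
  ext i
  obtain ⟨k, hk⟩ := hx i
  rw [fineGridVec_apply, ← hk, Int.floor_intCast, hk, mul_div_cancel_left₀ _ (NeZero.ne (N : ℝ))]

/-- **The additive equivalence `ℤⁿ ≃+ (1/N)ℤⁿ`, `k ↦ k/N`** (inverse: `x ↦ N x`). [folklore] -/
def fineGridEquiv : (Fin n → ℤ) ≃+ fineGrid n N where
  toFun k := ⟨fineGridVec n N k, fineGridVec_mem n N k⟩
  invFun x := fun i => ⌊(N : ℝ) * (x : EuclideanSpace ℝ (Fin n)) i⌋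
  left_inv k := by
    funext i
    simp only [fineGridVec_apply]
    rw [mul_div_cancel₀ _ (NeZero.ne (N : ℝ)), Int.floor_intCast]
  right_inv x := Subtype.ext (fineGridVec_floor_eq n N x.2)
  map_add' k l := Subtype.ext (fineGridVec_add n N k l)

/-- `fineGridEquiv k = k/N` in `ℝⁿ`. [folklore] -/
@[simp] theorem coe_fineGridEquiv (k : Fin n → ℤ) : ((fineGridEquiv n N k : fineGrid n N) : EuclideanSpace ℝ (Fin n)) = fineGridVec n N k :=
  rfl

/-! ### The Gaussian factorises on the grid -/

/-- `‖x‖² = ∑ᵢ xᵢ²` in `ℝⁿ`. [folklore] -/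
theorem norm_sq_eq_sum (x : EuclideanSpace ℝ (Fin n)) : ‖x‖ ^ 2 = ∑ i, (x i) ^ 2 := by
  rw [EuclideanSpace.norm_eq, Real.sq_sqrt (Finset.sum_nonneg fun i _ => sq_nonneg _)]
  simp

/-- **`ρ_s(k/N - t) = ∏ᵢ ρ_{Ns}(kᵢ - N tᵢ)`**: the spherical Gaussian factorises over the coordinates
of the grid, with the parameter and the centre scaled by `N`. [cite: MicciancioRegev2007, §2] -/
theorem gaussianFunction_fineGridVec_sub (s : ℝ) (t : EuclideanSpace ℝ (Fin n)) (k : Fin n → ℤ) :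
    gaussianFunction s (fineGridVec n N k - t) = ∏ i, gaussianFunction ((N : ℝ) * s) ((k i : ℝ) - N * t i) := by
  have hN : (N : ℝ) ≠ 0 := NeZero.ne (N : ℝ)
  unfold gaussianFunction
  rw [← Real.exp_sum, norm_sq_eq_sum, Finset.mul_sum, Finset.sum_div]
  congr 1
  refine Finset.sum_congr rfl fun i _ => ?_
  rw [Real.norm_eq_abs, sq_abs]
  simp only [PiLp.sub_apply, fineGridVec_apply]
  rcases eq_or_ne s 0 with hs | hs
  · simp [hs]
  · field_simp

variable {n N}

/-- **The discrete Gaussian on the grid is the product of scaled one-dimensional discrete Gaussians**: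
for `0 < s` and any centre `t`,
`D_{(1/N)ℤⁿ, s, t} = (⨂ᵢ D_{ℤ, Ns, N tᵢ}).map (k ↦ k/N)` — sampling `kᵢ ∼ D_{ℤ,Ns,Ntᵢ}` independently and
returning `k/N` samples the grid Gaussian exactly. (Both laws are proportional, on `k`, to
`∏ᵢ ρ_{Ns}(kᵢ - Ntᵢ)`.) [cite: GentryPeikertVaikuntanathan2008, §4.1] -/
theorem discreteGaussian_fineGrid_eq_map {s : ℝ} (hs : 0 < s) (t : EuclideanSpace ℝ (Fin n)) :
    discreteGaussian (fineGrid n N) s t =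
      (indepLaw n fun i => discreteGaussianInt ((N : ℝ) * s) ((N : ℝ) * t i)).map (fineGridEquiv n N) := by
  have hN : (0 : ℝ) < N := Nat.cast_pos.2 (Nat.pos_of_ne_zero (NeZero.ne N))
  have hNs : 0 < (N : ℝ) * s := mul_pos hN hs
  set F : fineGrid n N → ℝ≥0∞ := fun x =>
    ∏ i, ENNReal.ofReal (gaussianFunction ((N : ℝ) * s) ((((fineGridEquiv n N).symm x : Fin n → ℤ) i : ℝ) - N * t i))
    with hF
  refine PMF.eq_of_apply_eq_const_mul _ _ F (gaussianMass s t (fineGrid n N : Set (EuclideanSpace ℝ (Fin n))))⁻¹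
    (∏ i : Fin n, (gaussianMassInt ((N : ℝ) * s) ((N : ℝ) * t i))⁻¹) (fun x => ?_) (fun x => ?_)
  · -- the grid Gaussian: `ρ_s(x - t)/ρ(L') = (∏ ρᵢ) · ρ(L')⁻¹`
    rw [discreteGaussian_apply _ hs, mul_comm]
    congr 1
    have hx : (x : EuclideanSpace ℝ (Fin n)) = fineGridVec n N ((fineGridEquiv n N).symm x) := by
      rw [← coe_fineGridEquiv, AddEquiv.apply_symm_apply]
    rw [hx, gaussianFunction_fineGridVec_sub, ENNReal.ofReal_prod_of_nonneg fun i _ => (gaussianFunction_pos _ _).le]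
  · -- the product law pushed forward: `∏ Dᵢ(kᵢ) = (∏ ρᵢ) · ∏ Zᵢ⁻¹`
    have hx : x = fineGridEquiv n N ((fineGridEquiv n N).symm x) := ((fineGridEquiv n N).apply_symm_apply x).symm
    conv_lhs => rw [hx]
    rw [show ⇑(fineGridEquiv n N) = fun k => fineGridEquiv n N k from rfl,
      pmf_map_apply_of_injective _ (fineGridEquiv n N).injective, indepLaw_apply]
    simp only [discreteGaussianInt_apply hNs, hF]
    rw [Finset.prod_mul_distrib, mul_comm]

/-! ### Integer shifts of the centre -/

/-- The Gaussian mass of `ℤ` does not change under an integer shift of the centre. [folklore] -/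
theorem gaussianMassInt_add_intCast (s c : ℝ) (m : ℤ) : gaussianMassInt s (c + m) = gaussianMassInt s c := by
  unfold gaussianMassInt
  rw [← (Equiv.addRight m).tsum_eq]
  refine tsum_congr fun k => ?_
  simp only [Equiv.coe_addRight, Int.cast_add]
  congr 2
  ring

/-- **`D_{ℤ,s,c}(k) = D_{ℤ,s,c+m}(k + m)`** for an integer `m` (`0 < s`). [folklore] -/
theorem discreteGaussianInt_apply_add_intCast {s : ℝ} (hs : 0 < s) (c : ℝ) (m k : ℤ) :
    discreteGaussianInt s (c + m) (k + m) = discreteGaussianInt s c k := by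
  rw [discreteGaussianInt_apply hs, discreteGaussianInt_apply hs, gaussianMassInt_add_intCast]
  congr 3
  push_cast
  ring

/-- **Integer shift of the centre**: `(D_{ℤ,s,c}).map (· + m) = D_{ℤ,s,c+m}` for `m ∈ ℤ` — a sampler
for the centred law gives every integer centre. [cite: GentryPeikertVaikuntanathan2008, §4.1] -/
theorem discreteGaussianInt_map_add_int {s : ℝ} (hs : 0 < s) (c : ℝ) (m : ℤ) :
    (discreteGaussianInt s c).map (· + m) = discreteGaussianInt s (c + m) := by
  ext k
  have hk : k = (k - m) + m := by ring
  conv_lhs => rw [hk]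
  rw [pmf_map_apply_of_injective _ (add_left_injective m), ← discreteGaussianInt_apply_add_intCast hs c m (k - m),
    ← hk]

/-- **Coordinatewise integer shifts of a product of centred discrete Gaussians**:
`(⨂ᵢ D_{ℤ,σᵢ,cᵢ}).map (· + m) = ⨂ᵢ D_{ℤ,σᵢ,cᵢ+mᵢ}` for an integer vector `m`. [folklore] -/
theorem indepLaw_discreteGaussianInt_map_add {K : ℕ} {σ : Fin K → ℝ} (hσ : ∀ i, 0 < σ i) (c : Fin K → ℝ)
    (m : Fin K → ℤ) :
    (indepLaw K fun i => discreteGaussianInt (σ i) (c i)).map (· + m) =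
      indepLaw K fun i => discreteGaussianInt (σ i) (c i + m i) := by
  refine indepLaw_eq_of_apply _ _ fun v => ?_
  have hv : v = (v - m) + m := by abel
  conv_lhs => rw [hv]
  rw [pmf_map_apply_of_injective _ (add_left_injective m), indepLaw_apply]
  refine Finset.prod_congr rfl fun i _ => ?_
  rw [Pi.sub_apply, ← discreteGaussianInt_apply_add_intCast (hσ i) (c i) (m i) (v i - m i), sub_add_cancel]

/-- **The grid Gaussian with a grid centre from CENTRED one-dimensional samples**: if `t = m/N` is a
grid vector then `D_{(1/N)ℤⁿ, s, t}` is the law of `(k + m)/N` for `k ∼ ⨂ᵢ D_{ℤ, Ns, 0}`.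
[cite: MicciancioRegev2007, Lemma 5.7 (fine-grid form)] -/
theorem discreteGaussian_fineGrid_fineGridVec_eq_map {s : ℝ} (hs : 0 < s) (m : Fin n → ℤ) :
    discreteGaussian (fineGrid n N) s (fineGridVec n N m) =
      ((indepLaw n fun _ => discreteGaussianInt ((N : ℝ) * s) 0).map (· + m)).map (fineGridEquiv n N) := by
  have hN : (0 : ℝ) < N := Nat.cast_pos.2 (Nat.pos_of_ne_zero (NeZero.ne N))
  rw [discreteGaussian_fineGrid_eq_map hs,
    indepLaw_discreteGaussianInt_map_add (fun _ => mul_pos hN hs) (fun _ => (0 : ℝ)) m]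
  congr 1
  refine congrArg (indepLaw n) (funext fun i => ?_)
  congr 1
  rw [fineGridVec_apply, zero_add, mul_div_cancel₀ _ hN.ne']

end Literature.Algebra.EuclideanLattices

end
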